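import Summits.QuantumAdvantage.QuantumAdvantage.Theorems.CubicForrelationNearExactIsExactSecondWeight

/-!
# Crux `CubicForrelation.NearExactIsExact` (stmt-QuantumAdvantage-14043) — n = 12: E1280 is LOCAL ON SUBSPACES — one 64-element
  subspace of directions with no light derivative forces `e ≥ 1286`

Certificate seat `b2b-cforr-cert` (gen 34).  HONEST FRAMING: a kernel-checked elementary counting lemma (standard axioms) about Boolean
functions on 12 bits; it closes nothing by itself and is NOT summit progress.  It is the subspace ("Bose–Burton") form of the
localisation …TwelveDigitLowRank (HOME/b2b-cforr-cert-g34/PLAN-N12-LOWRANK.md §12).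

* `tdls_weight_window_of_subspace`: let `κ` be any Boolean function on 12 bits, `e = #{κ = 1}`, and `V` an xor-closed set of 64 directions
  containing `0` (a 6-dimensional subspace) such that for every `a ∈ V ∖ 0` the derivative `D_aκ = κ ⊕ κ(· ⊕ a)` has at least `1792` ones.
  Then `1286 ≤ e ≤ 2810`.  Proof: `Σ_{a∈V} Σ_x (−1)^{κ(x)+κ(x⊕a)} = Σ_{cosets T of V} (Σ_{x∈T} (−1)^{κ(x)})² ≥ (4096 − 2e)²/64`
  (Cauchy–Schwarz over the 64 cosets), while the left side is `≤ 4096 + 63·512`.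
* `tdls_e_ge_1288_of_subspace`: with `8 ∣ e` this gives `e ≥ 1288`.

USE (paper).  For the digit class `κ` of a type-O cubic `g` on 12 bits a direction `a` has `#D_aκ ≥ 1792` as soon as the slice `ι_a C*` of
the matching dual has rank `≥ 6` (`tdq_frame_card`), so the hypothesis holds for any 6-dimensional subspace `V ⊂ 𝔽₂¹²` avoiding the set
`N := {a ≠ 0 : rank ι_a C* ≤ 4}` (`#N = N₂ + N₄`).  By the Bose–Burton bound in the form already in the tree
(`NearExactIsExact.Negative.XorSpanAvoid.exists_lcomb_avoiding`: `(#N + 1)·2^6 < 2^13`, i.e. `#N ≤ 126`, gives six independent directions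
all of whose non-trivial combinations avoid `N`) such a `V` exists whenever `N₂(C*) + N₄(C*) ≤ 126`.  Hence
  `E1280 (⇒ θ₁₂ = 57/64, …TwelveDigitWeightReduction)  ⟸  N₂(C*) + N₄(C*) ≤ 126` for every type-O `C` with `#PM(C*)` even
— more generally ⟸ "the directions of slice rank ≤ 4 of `C*` do not block the 6-dimensional subspaces".  Numerically (kit j212619,
651 069 even-`#PM(C*)` duals): `N₂ + N₄ ≤ 84`; odd duals reach `322` (four blocks) but contain rank-≥6 6-spaces anyway (a `[4,2,3]` MDS code
over `GF(8)` inside `(𝔽₂³)⁴`), consistent with `e = 1400 ≥ 1286` there.  The companion lemma …TwelveDigitLowRank needs `3N₂ + N₄ ≤ 601`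
globally; this one needs one clean 6-space.

References: R. C. Bose, R. C. Burton, J. Combin. Theory 1 (1966) 96–104 (Thm. 1); F. J. MacWilliams, N. J. A. Sloane (1977) Ch. 15.
Axioms: the standard three.
-/

set_option linter.dupNamespace false -- D-0017: single-problem summit ⇒ `QuantumAdvantage.QuantumAdvantage` by design

noncomputable section

namespace Summit.QuantumAdvantage.QuantumAdvantage.Theorems.CubicForrelation.NearExactIsExact

open Finset
open Literature.Computability.QuantumComplexity
open Literature.Computability.QuantumComplexity.BuzetChailloux (bxor zeroVec bxor_zeroVec bxor_bxor_cancel_left)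

section Subspace

/-- `Σ_x (−1)^{κ x ⊕ κ(x ⊕ a)} = 4096 − 2·#{x : κ x ≠ κ (x ⊕ a)}` on 12 bits (signs written as `if … then −1 else 1`). [folklore] -/
theorem tdls_autocorr_eq (κ : (Fin (6 + 6) → Bool) → Bool) (a : Fin (6 + 6) → Bool) :
    ∑ x : Fin (6 + 6) → Bool, (if κ x = true then (-1 : ℤ) else 1) * (if κ (bxor x a) = true then (-1 : ℤ) else 1) =
      4096 - 2 * (#(univ.filter fun x : Fin (6 + 6) → Bool => (κ x ^^ κ (bxor x a)) = true) : ℤ) := by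
  have e : ∀ x : Fin (6 + 6) → Bool,
      (if κ x = true then (-1 : ℤ) else 1) * (if κ (bxor x a) = true then (-1 : ℤ) else 1) =
        1 - 2 * (if (κ x ^^ κ (bxor x a)) = true then (1 : ℤ) else 0) := fun x => by
    cases κ x <;> cases κ (bxor x a) <;> simp
  rw [sum_congr rfl fun x _ => e x, sum_sub_distrib, sum_const, ← mul_sum, sum_boole, card_univ, Fintype.card_fun,
    Fintype.card_bool, Fintype.card_fin]
  norm_num

/-- **Subspace localisation.**  If an xor-closed `V ∋ 0` with `#V = 64` has `#{D_aκ = 1} ≥ 1792` for every `a ∈ V ∖ 0`, then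
`1286 ≤ #{κ = 1} ≤ 2810`.  (Cauchy–Schwarz over the 64 cosets of `V`.) [this work] -/
theorem tdls_weight_window_of_subspace (κ : (Fin (6 + 6) → Bool) → Bool) (V : Finset (Fin (6 + 6) → Bool))
    (h0 : zeroVec ∈ V) (hV : ∀ x ∈ V, ∀ y ∈ V, bxor x y ∈ V) (hcard : #V = 64)
    (h6 : ∀ a ∈ V, a ≠ zeroVec → 1792 ≤ #(univ.filter fun x : Fin (6 + 6) → Bool => (κ x ^^ κ (bxor x a)) = true)) :
    1286 ≤ #(univ.filter fun x : Fin (6 + 6) → Bool => κ x = true) ∧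
      #(univ.filter fun x : Fin (6 + 6) → Bool => κ x = true) ≤ 2810 := by
  classical
  set e := #(univ.filter fun x : Fin (6 + 6) → Bool => κ x = true) with he
  -- notation
  set K : (Fin (6 + 6) → Bool) → ℤ := fun x => if κ x = true then (-1 : ℤ) else 1 with hK
  set orb : (Fin (6 + 6) → Bool) → Finset (Fin (6 + 6) → Bool) := fun x => V.image (bxor x) with horb
  set S : Finset (Fin (6 + 6) → Bool) → ℤ := fun T => ∑ y ∈ T, K y with hSdef
  set Orbs : Finset (Finset (Fin (6 + 6) → Bool)) := univ.image orb with hOrbs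
  have hU : #(univ : Finset (Fin (6 + 6) → Bool)) = 4096 := by
    rw [card_univ, Fintype.card_fun, Fintype.card_bool, Fintype.card_fin]; norm_num
  -- the fibre of the orbit map over `orb x` is `orb x`
  have hfib : ∀ x : Fin (6 + 6) → Bool, (univ.filter fun a => orb a = orb x) = orb x := by
    intro x
    have h := iw_fiber_eq_orbit (fun _ : Fin (6 + 6) → Bool => true) h0 hV (fun _ _ _ => rfl) (x := x) rfl
    have hu : (univ.filter fun a : Fin (6 + 6) → Bool => true = true) = univ := by
      ext a; simp
    rw [hu] at h
    exact h
  -- (A) inner sum over `V` is the coset sum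
  have hA : ∀ x, ∑ a ∈ V, K (bxor x a) = S (orb x) := by
    intro x
    rw [hSdef, horb]
    simp only
    rw [sum_image fun a _ b _ hab => iw_bxor_injective x hab]
  -- (B) total = Σ_T S_T²
  have hmaps : ∀ x ∈ (univ : Finset (Fin (6 + 6) → Bool)), orb x ∈ Orbs := fun x _ => mem_image_of_mem _ (mem_univ x)
  have hB : ∑ a ∈ V, ∑ x, K x * K (bxor x a) = ∑ T ∈ Orbs, S T * S T := by
    rw [sum_comm]
    have h1 : ∑ x, ∑ a ∈ V, K x * K (bxor x a) = ∑ x, K x * S (orb x) := by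
      refine sum_congr rfl fun x _ => ?_
      rw [← mul_sum, hA]
    rw [h1, ← sum_fiberwise_of_maps_to hmaps (fun x => K x * S (orb x))]
    refine sum_congr rfl fun T hT => ?_
    obtain ⟨x, -, rfl⟩ := mem_image.1 hT
    rw [hfib x]
    have h2 : ∑ y ∈ orb x, K y * S (orb y) = ∑ y ∈ orb x, K y * S (orb x) := by
      refine sum_congr rfl fun y hy => ?_
      obtain ⟨u, hu, rfl⟩ := mem_image.1 hy
      rw [horb]
      simp only
      rw [iw_orbit_shift hV x hu]
    rw [h2, ← sum_mul]
  -- (C) number of orbits = 64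
  have hOcard : #Orbs = 64 := by
    have h := card_eq_sum_card_image orb (univ : Finset (Fin (6 + 6) → Bool))
    have h' : ∀ T ∈ Orbs, #(univ.filter fun a => orb a = T) = 64 := by
      intro T hT
      obtain ⟨x, -, rfl⟩ := mem_image.1 hT
      rw [hfib x, horb]
      simp only
      rw [iw_card_orbit, hcard]
    rw [sum_congr rfl h', sum_const, smul_eq_mul, hU] at h
    omega
  -- (D) Σ_T S_T = Σ_x K x = 4096 − 2e, and Cauchy–Schwarz
  have hsumS : ∑ T ∈ Orbs, S T = ∑ x, K x := by
    rw [← sum_fiberwise_of_maps_to hmaps (fun x => K x)]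
    refine sum_congr rfl fun T hT => ?_
    obtain ⟨x, -, rfl⟩ := mem_image.1 hT
    rw [hfib x]
  have hKsum : ∑ x, K x = 4096 - 2 * (e : ℤ) := by
    have e1 : ∀ x, K x = 1 - 2 * (if κ x = true then (1 : ℤ) else 0) := fun x => by
      rw [hK]; simp only; split_ifs <;> norm_num
    rw [sum_congr rfl fun x _ => e1 x, sum_sub_distrib, sum_const, ← mul_sum, sum_boole, hU, he]
    norm_num
  have hCS : (∑ T ∈ Orbs, S T) ^ 2 ≤ #Orbs * ∑ T ∈ Orbs, S T ^ 2 := sq_sum_le_card_mul_sum_sq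
  rw [hOcard, hsumS, hKsum] at hCS
  have hsq : ∑ T ∈ Orbs, S T ^ 2 = ∑ a ∈ V, ∑ x, K x * K (bxor x a) := by
    rw [hB]; exact sum_congr rfl fun T _ => by ring
  rw [hsq] at hCS
  -- (E) bound each term
  have hle : e ≤ 4096 := (card_le_univ _).trans_eq hU
  have hterm : ∀ a ∈ V, ∑ x, K x * K (bxor x a) ≤ if a = zeroVec then 4096 else 512 := by
    intro a ha
    have hk : ∑ x, K x * K (bxor x a) =
        ∑ x : Fin (6 + 6) → Bool, (if κ x = true then (-1 : ℤ) else 1) * (if κ (bxor x a) = true then (-1 : ℤ) else 1) := rfl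
    rw [hk, tdls_autocorr_eq κ a]
    split_ifs with haz
    · set w := #(univ.filter fun x : Fin (6 + 6) → Bool => (κ x ^^ κ (bxor x a)) = true) with hw
      have : (0 : ℤ) ≤ (w : ℤ) := Nat.cast_nonneg _
      linarith
    · set w := #(univ.filter fun x : Fin (6 + 6) → Bool => (κ x ^^ κ (bxor x a)) = true) with hw
      have h6a : 1792 ≤ w := h6 a ha haz
      have h' : (1792 : ℤ) ≤ (w : ℤ) := by exact_mod_cast h6a
      linarith
  have htot : ∑ a ∈ V, ∑ x, K x * K (bxor x a) ≤ 36352 := by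
    refine (sum_le_sum hterm).trans ?_
    rw [sum_ite, sum_const, sum_const, nsmul_eq_mul, nsmul_eq_mul]
    have hz : #(V.filter fun a => a = zeroVec) = 1 := by
      rw [card_eq_one]; refine ⟨zeroVec, ?_⟩
      ext a; simp only [mem_filter, mem_singleton]
      exact ⟨fun h => h.2, fun h => ⟨h ▸ h0, h⟩⟩
    have hnz : #(V.filter fun a => ¬ a = zeroVec) = 63 := by
      have h := card_filter_add_card_filter_not (s := V) (fun a => a = zeroVec)
      rw [hz, hcard] at h
      omega
    rw [hz, hnz]
    norm_num
  -- (4096 − 2e)² ≤ 64·36352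
  push_cast at hCS
  have hmain : (4096 - 2 * (e : ℤ)) ^ 2 ≤ 64 * 36352 := hCS.trans (by linarith [htot])
  constructor
  · by_contra hlt
    rw [not_le] at hlt
    have h' : (e : ℤ) ≤ 1285 := by exact_mod_cast Nat.lt_succ_iff.1 hlt
    nlinarith
  · by_contra hgt
    rw [not_le] at hgt
    have h' : (2811 : ℤ) ≤ (e : ℤ) := by exact_mod_cast hgt
    nlinarith

/-- **E1280 from one clean 6-space.**  Under the hypotheses of `tdls_weight_window_of_subspace`, a support of size divisible by `8`
(e.g. the support of a cubic on 12 bits) has `e ≥ 1288`. [this work] -/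
theorem tdls_e_ge_1288_of_subspace (κ : (Fin (6 + 6) → Bool) → Bool) (V : Finset (Fin (6 + 6) → Bool))
    (h0 : zeroVec ∈ V) (hV : ∀ x ∈ V, ∀ y ∈ V, bxor x y ∈ V) (hcard : #V = 64)
    (h6 : ∀ a ∈ V, a ≠ zeroVec → 1792 ≤ #(univ.filter fun x : Fin (6 + 6) → Bool => (κ x ^^ κ (bxor x a)) = true))
    (h8 : 8 ∣ #(univ.filter fun x : Fin (6 + 6) → Bool => κ x = true)) :
    1288 ≤ #(univ.filter fun x : Fin (6 + 6) → Bool => κ x = true) := by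
  have h := (tdls_weight_window_of_subspace κ V h0 hV hcard h6).1
  omega

end Subspace

end Summit.QuantumAdvantage.QuantumAdvantage.Theorems.CubicForrelation.NearExactIsExact

end
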